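import Summits.QuantumFields.YangMills.Theorems.ColdStartUniversalityShenZhuZhuLargeNFactorisationSUN
import HarnessLib

/-!
# LARGE-`N` SELF-AVERAGING OF WILSON LOOPS IN FINITE VOLUME, uniformly in the volume: Chebyshev deviation bounds on every torus `(ℤ/L)^d` for every
# `SU(N)`, every `d`, at `|β| < 1/(8d)` — `μ_{Λ_L,Nβ}{|W_C − ⟨W_C⟩| ≥ ε} ≤ Σ_e mult_C(e)²/(N K ε²)`, `K = N/2 − 4dN|β|`, hence `O(1/N²)` for every `L`

Seat `ym-line-csu-p1` (g39), route `ColdStartUniversality` of `Summits/QuantumFields/YangMills`, helper file G29 (strong coupling;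
`--supports stmt-QuantumFields-24809`).  G26 proved Shen–Zhu–Zhu's Corollary 1.5 (large-`N` concentration and factorisation of Wilson loops) for the
INFINITE-volume limit points.  The finite-volume statement — on EVERY torus, with a bound that does not see `L` — is what a lattice simulation at large
`N` uses; it follows from G23's torus variance bounds (`torus_wilsonLoop_variance_sun`, `torus_cylinder_variance_sun`) by Chebyshev:

* §1 `torus_wilsonLoopIm_variance_sun` — the imaginary part too: `Var_{Λ_L,Nβ}(Im tr hol_C/N) ≤ Σ_e mult_C(e)²/(N K)` (G25's Lipschitz cylinder).
* §2 ★★★ `torus_wilsonLoop_deviation_sun` — `μ_{Λ_L,Nβ}{ε ≤ |W_C − ⟨W_C⟩_{Λ_L,Nβ}|} ≤ Σ_e mult_C(e)²/(N K ε²)` for every closed walk whose links stay distinct on the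
  torus; ★★★ `torus_wilsonLoop_rect_deviation_sun` — tree vocabulary: `μ{ε ≤ |wilsonLoop ρ x i j R T − ⟨…⟩|} ≤ 2(R+T)/(N K ε²)`, `1 ≤ R, T < L`.
* §3 ★★★ `tendsto_torus_wilsonLoop_rect_deviation_largeN` — for fixed `R, T, ε` and ANY torus sizes `L_N > max(R,T)`:
  `μ_{Λ_{L_N}, Nβ}{ε ≤ |W_{R×T} − ⟨W_{R×T}⟩|} → 0` as `N → ∞` (`≤ 2(R+T)/((1/2 − 4d|β|) N² ε²)`): large-`N` self-averaging in finite volume, uniformly in the volume.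

THEOREMS ONLY, no definition, no sorry.  HONEST FRAMING: STRONG coupling (`|β| < 1/(8d)`, 't Hooft scaling), FIXED finite tori; nothing at weak coupling /
in the continuum, nothing `K`-uniform along the route's scaling (`UniformColdStartMixing`, 24809, ASIDE, not restated); no crux, rung or summit statement is
proved; the Yang–Mills mass gap is NOT proved.

References: H. Shen, R. Zhu, X. Zhu, CMP 400 (2023) 805–851 = arXiv:2204.12737, Cor. 1.5 (1.12)–(1.13), Rem. 4.6 [ShenZhuZhu2022].
-/

set_option autoImplicit false

noncomputable section

namespace Summit.QuantumFields.YangMills.Theorems.ColdStartUniversality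

open MeasureTheory ProbabilityTheory Finset Filter Set Function
open scoped BigOperators NNReal ENNReal Topology Matrix Matrix.Norms.Frobenius ContDiff
open SimpleGraph
open Literature.Probability.LatticeModels (zdGraph Torus.proj Torus.proj_apply)
open Literature.MathematicalPhysics.QuantumFieldTheory
open Literature.MathematicalPhysics.QuantumLattice (fundamentalRep continuous_fundamentalRep fundamentalRep_apply torusEdge torusLift LGConfig
  normalisedCharacter wilsonLoopObs rectWalk)
open Literature.MathematicalPhysics.QuantumFieldTheory.SUNBakryEmery (SUN)
open Summit.Ventures.YMGap.RobustBall (dartMult)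

variable {d N L : ℕ} [NeZero L]

/-! ## §1. The imaginary part on the torus -/

/-- **Variance of `Im tr hol_C/N` on every torus, every `SU(N)`, every `d`**: `Var_{Λ_L,Nβ}(Im tr hol_C(lift)/N) ≤ Σ_e mult_C(e)²/(N K)`,
`K = N/2 − 4dN|β|`, for every closed walk whose links stay distinct on the torus.  The Yang–Mills mass gap is NOT proved. [cite: ShenZhuZhu2022, Remark 4.6] -/
theorem torus_wilsonLoopIm_variance_sun (hN : N ≠ 0) {β : ℝ} (hK : 0 < (N : ℝ) / 2 - N * |β| * (4 * d))
    {x : Literature.Probability.LatticeModels.Site d} (w : (zdGraph d).Walk x x) (hinj : Set.InjOn (torusEdge (d := d) L) ↑(walkEdges w)) :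
    Var[fun V : GaugeConfig d L (SUN N) => (wilsonLoopTrace (fundamentalRep (Fin N)) w (torusLift L V)).im / N;
        wilsonMeasure (d := d) (L := L) (fundamentalRep (Fin N)) ((N : ℝ) * β)] ≤
      (∑ e ∈ walkEdges w, (dartMult w e : ℝ) ^ 2) / (N * ((N : ℝ) / 2 - N * |β| * (4 * d))) := by
  classical
  obtain ⟨f, hf, hrep, hLip⟩ := exists_smooth_linkLipschitz_wilsonLoopIm (N := N) w
  set ℓ : ↥(walkEdges w) → ℝ := fun e =>
    (dartMult w (e : Literature.MathematicalPhysics.QuantumLattice.ZdEdge d) : ℝ) / Real.sqrt (N : ℝ) with hℓdef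
  have hℓ : ∀ e, 0 ≤ ℓ e := fun e => div_nonneg (Nat.cast_nonneg _) (Real.sqrt_nonneg _)
  have hsum : ∑ e, ℓ e ^ 2 = (∑ e ∈ walkEdges w, (dartMult w e : ℝ) ^ 2) / N := by
    have h2 : Real.sqrt (N : ℝ) ^ 2 = N := Real.sq_sqrt (Nat.cast_nonneg _)
    simp only [hℓdef, div_pow, h2]
    rw [← Finset.sum_div, Finset.sum_coe_sort (walkEdges w) (fun e => (dartMult w e : ℝ) ^ 2)]
  have h := torus_cylinder_variance_sun (L := L) hN hK (walkEdges w) hinj f hf ℓ hℓ hLip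
  have hF : (fun V : GaugeConfig d L (SUN N) => matrixCylinder (walkEdges w) f (torusLift L V)) =
      fun V => (wilsonLoopTrace (fundamentalRep (Fin N)) w (torusLift L V)).im / N := funext fun V => hrep _
  rw [hF, hsum, div_div] at h
  exact h

/-! ## §2. Chebyshev deviation bounds on every torus -/

/-- ★★★ **Self-averaging of Wilson loops on every torus, every `SU(N)`, every `d`**: for `K = N/2 − 4dN|β| > 0`, every closed lattice walk `C` whose links stay
distinct on `(ℤ/L)^d` and every `ε > 0`,  `μ_{Λ_L,Nβ}{ε ≤ |W_C∘lift − ⟨W_C∘lift⟩|} ≤ Σ_{e∈links(C)} mult_C(e)²/(N K ε²)`  (Chebyshev and G23).  The bound does not see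
`L`.  The Yang–Mills mass gap is NOT proved. [cite: ShenZhuZhu2022, Corollary 1.5 (1.13)] -/
theorem torus_wilsonLoop_deviation_sun (hN : N ≠ 0) {β : ℝ} (hK : 0 < (N : ℝ) / 2 - N * |β| * (4 * d))
    {x : Literature.Probability.LatticeModels.Site d} (w : (zdGraph d).Walk x x) (hinj : Set.InjOn (torusEdge (d := d) L) ↑(walkEdges w))
    {ε : ℝ} (hε : 0 < ε) :
    (wilsonMeasure (d := d) (L := L) (fundamentalRep (Fin N)) ((N : ℝ) * β)).real
        {V | ε ≤ |wilsonLoopObs (fun g : SUN N => normalisedCharacter N (fundamentalRep (Fin N) g)) w (torusLift L V) -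
          ∫ V', wilsonLoopObs (fun g : SUN N => normalisedCharacter N (fundamentalRep (Fin N) g)) w (torusLift L V')
            ∂(wilsonMeasure (d := d) (L := L) (fundamentalRep (Fin N)) ((N : ℝ) * β))|} ≤
      (∑ e ∈ walkEdges w, (dartMult w e : ℝ) ^ 2) / (N * ((N : ℝ) / 2 - N * |β| * (4 * d)) * ε ^ 2) := by
  classical
  haveI : SecondCountableTopology (Matrix (Fin N) (Fin N) ℂ) := inferInstanceAs (SecondCountableTopology (Fin N → Fin N → ℂ))
  haveI : SecondCountableTopology (SUN N) := Topology.IsEmbedding.subtypeVal.secondCountableTopology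
  set μ := wilsonMeasure (d := d) (L := L) (fundamentalRep (Fin N)) ((N : ℝ) * β) with hμ
  haveI : IsProbabilityMeasure μ := isProbabilityMeasure_wilsonMeasure (d := d) (L := L) (fundamentalRep (Fin N)) (continuous_fundamentalRep (Fin N)) _
  set X : GaugeConfig d L (SUN N) → ℝ := fun V =>
    wilsonLoopObs (fun g : SUN N => normalisedCharacter N (fundamentalRep (Fin N) g)) w (torusLift L V) with hX
  -- continuity (hence square integrability) through the smooth-cylinder representation
  obtain ⟨f, hf, hrep, -⟩ := exists_smooth_linkLipschitz_wilsonLoopObs (N := N) w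
  have hres : Continuous fun V : GaugeConfig d L (SUN N) =>
      (fun e' : ↥(walkEdges w) => ((torusLift L V e'.1 : SUN N) : Matrix (Fin N) (Fin N) ℂ)) :=
    continuous_pi fun e => continuous_subtype_val.comp (continuous_apply _)
  have hXc : Continuous X := by
    have hXf : X = fun V => matrixCylinder (walkEdges w) f (torusLift L V) := funext fun V => (hrep _).symm
    rw [hXf]; exact hf.continuous.comp hres
  obtain ⟨C, hC⟩ := (isCompact_univ (X := GaugeConfig d L (SUN N))).exists_bound_of_continuousOn hXc.continuousOn
  have hmem : MemLp X 2 μ := MemLp.of_bound hXc.aestronglyMeasurable C (ae_of_all _ fun V => hC V (Set.mem_univ _))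
  have hcheb := meas_ge_le_variance_div_sq hmem hε
  have hvar := torus_wilsonLoop_variance_sun (L := L) hN hK w hinj
  have hKN : 0 < (N : ℝ) * ((N : ℝ) / 2 - N * |β| * (4 * d)) := mul_pos (by exact_mod_cast Nat.pos_of_ne_zero hN) hK
  have hv0 : 0 ≤ Var[X; μ] / ε ^ 2 := div_nonneg (variance_nonneg _ _) (sq_nonneg ε)
  calc μ.real {V | ε ≤ |X V - ∫ V', X V' ∂μ|} = (μ {V | ε ≤ |X V - μ[X]|}).toReal := rfl
    _ ≤ Var[X; μ] / ε ^ 2 := ENNReal.toReal_le_of_le_ofReal hv0 hcheb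
    _ ≤ (∑ e ∈ walkEdges w, (dartMult w e : ℝ) ^ 2) / (N * ((N : ℝ) / 2 - N * |β| * (4 * d))) / ε ^ 2 :=
        div_le_div_of_nonneg_right hvar (sq_nonneg ε)
    _ = (∑ e ∈ walkEdges w, (dartMult w e : ℝ) ^ 2) / (N * ((N : ℝ) / 2 - N * |β| * (4 * d)) * ε ^ 2) := by rw [div_div]

/-- ★★★ **Self-averaging of rectangular Wilson loops on every torus (tree vocabulary), every `SU(N)`, every `d`**: for `K = N/2 − 4dN|β| > 0`, every base point,
`i ≠ j`, `1 ≤ R, T < L` and `ε > 0`:  `μ_{Λ_L,Nβ}{ε ≤ |W_{R×T} − ⟨W_{R×T}⟩|} ≤ 2(R+T)/(N K ε²)` (`W = wilsonLoop (fundamentalRep (Fin N)) x i j R T`).  The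
Yang–Mills mass gap is NOT proved. [cite: ShenZhuZhu2022, Corollary 1.5 (1.13)] -/
theorem torus_wilsonLoop_rect_deviation_sun (hN : N ≠ 0) {β : ℝ} (hK : 0 < (N : ℝ) / 2 - N * |β| * (4 * d))
    (x : Literature.MathematicalPhysics.QuantumFieldTheory.Site d L) {i j : Fin d} (hij : i ≠ j) {R T : ℕ} (hR : 1 ≤ R) (hT : 1 ≤ T) (hRL : R < L) (hTL : T < L)
    {ε : ℝ} (hε : 0 < ε) :
    (wilsonMeasure (d := d) (L := L) (fundamentalRep (Fin N)) ((N : ℝ) * β)).real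
        {V | ε ≤ |wilsonLoop (fundamentalRep (Fin N)) x i j R T V -
          ∫ V', wilsonLoop (fundamentalRep (Fin N)) x i j R T V' ∂(wilsonMeasure (d := d) (L := L) (fundamentalRep (Fin N)) ((N : ℝ) * β))|} ≤
      2 * ((R : ℝ) + T) / (N * ((N : ℝ) / 2 - N * |β| * (4 * d)) * ε ^ 2) := by
  classical
  set x₀ : Literature.Probability.LatticeModels.Site d := fun k => ((x k).val : ℤ) with hx₀
  have hx : Torus.proj L x₀ = x := by
    funext k
    rw [Torus.proj_apply, hx₀]
    simp only [Int.cast_natCast, ZMod.natCast_zmod_val]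
  have hW : ∀ V : GaugeConfig d L (SUN N),
      wilsonLoopObs (fun g : SUN N => normalisedCharacter N (fundamentalRep (Fin N) g)) (rectWalk x₀ i j R T) (torusLift L V) =
        wilsonLoop (fundamentalRep (Fin N)) x i j R T V := by
    intro V; rw [wilsonLoopObs_rectWalk_torusLift, hx]
  have h := torus_wilsonLoop_deviation_sun (L := L) hN hK (rectWalk x₀ i j R T) (injOn_torusEdge_walkEdges_rectWalk L x₀ hij hRL hTL) hε
  simp_rw [hW] at h
  rw [sum_dartMult_sq_rectWalk x₀ hij hR hT] at h
  exact h

/-! ## §3. Large `N`: self-averaging in finite volume, uniformly in the volume -/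

/-- ★★★ **Large-`N` self-averaging of Wilson loops in FINITE volume, uniformly in the volume**: for `d ≥ 1`, `|β| < 1/(8d)`, fixed `i ≠ j`, `1 ≤ R, T`, `ε > 0`
and ANY torus sizes `L_N + 1 > max(R, T)` with base points `x_N`:  `μ_{Λ_{L_N+1}, Nβ}{ε ≤ |W_{R×T} − ⟨W_{R×T}⟩|} → 0` as `N → ∞`
(indeed `≤ 2(R+T)/((1/2 − 4d|β|) N ε²)`).  The Yang–Mills mass gap is NOT proved. [cite: ShenZhuZhu2022, Corollary 1.5 (1.13)] -/
theorem tendsto_torus_wilsonLoop_rect_deviation_largeN (hd : 1 ≤ d) {β : ℝ} (hβ : |β| < 1 / (8 * d)) {i j : Fin d} (hij : i ≠ j)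
    {R T : ℕ} (hR : 1 ≤ R) (hT : 1 ≤ T) (Ls : ℕ → ℕ) (hRL : ∀ N, R < Ls N + 1) (hTL : ∀ N, T < Ls N + 1)
    (x : (N : ℕ) → Literature.MathematicalPhysics.QuantumFieldTheory.Site d (Ls N + 1)) {ε : ℝ} (hε : 0 < ε) :
    Tendsto (fun N : ℕ => (wilsonMeasure (d := d) (L := Ls N + 1) (fundamentalRep (Fin N)) ((N : ℝ) * β)).real
        {V | ε ≤ |wilsonLoop (fundamentalRep (Fin N)) (x N) i j R T V -
          ∫ V', wilsonLoop (fundamentalRep (Fin N)) (x N) i j R T V' ∂(wilsonMeasure (d := d) (L := Ls N + 1) (fundamentalRep (Fin N)) ((N : ℝ) * β))|})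
      atTop (𝓝 0) := by
  have hc := sharpWindow_const_pos hd hβ
  have hg : Tendsto (fun N : ℕ => 2 * ((R : ℝ) + T) / ((1 / 2 - 4 * (d : ℝ) * |β|) * ε ^ 2) / (N : ℝ)) atTop (𝓝 0) :=
    tendsto_const_div_atTop_nhds_zero_nat _
  refine squeeze_zero' (Eventually.of_forall fun N => measureReal_nonneg) ?_ hg
  filter_upwards [eventually_ge_atTop 1] with N hN
  obtain ⟨hK, -⟩ := sharpWindow_const_le hd hβ hN
  have hN0 : N ≠ 0 := by omega
  have hN' : (1 : ℝ) ≤ N := by exact_mod_cast hN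
  have hdev := torus_wilsonLoop_rect_deviation_sun (d := d) (L := Ls N + 1) hN0 hK (x N) hij hR hT (hRL N) (hTL N) hε
  refine hdev.trans ?_
  -- `N K_N ε² = N² (1/2 − 4d|β|) ε² ≥ N (1/2 − 4d|β|) ε²`
  have hRT : 0 ≤ 2 * ((R : ℝ) + T) := by positivity
  have hKN : (N : ℝ) * ((N : ℝ) / 2 - N * |β| * (4 * d)) * ε ^ 2 = (N : ℝ) * N * ((1 / 2 - 4 * (d : ℝ) * |β|) * ε ^ 2) := by ring
  rw [hKN, div_div, show (1 / 2 - 4 * (d : ℝ) * |β|) * ε ^ 2 * (N : ℝ) = (N : ℝ) * ((1 / 2 - 4 * (d : ℝ) * |β|) * ε ^ 2) by ring]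
  refine div_le_div_of_nonneg_left hRT (by positivity) ?_
  have hcε : 0 < (1 / 2 - 4 * (d : ℝ) * |β|) * ε ^ 2 := by positivity
  have h1 : 0 ≤ (N : ℝ) * ((1 / 2 - 4 * (d : ℝ) * |β|) * ε ^ 2) * ((N : ℝ) - 1) :=
    mul_nonneg (mul_nonneg (by linarith) hcε.le) (by linarith)
  nlinarith [h1]

end Summit.QuantumFields.YangMills.Theorems.ColdStartUniversality

end
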